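import Summits.QuantumFields.YangMills.Theorems.BalabanUVNodesN15CovariantLandauLeibniz
import Summits.QuantumFields.YangMills.Theorems.BalabanUVNodesN15CovariantLandauNeumannRows
import HarnessLib

/-!
# Route «BalabanUVNodes», node N15 = NE2, road (c) — PROGRAMME (P-S), XVI: THE SUP-BLOCK ROWS OF THE LOCAL OPERATORS OF THE LEIBNIZ ALGEBRA — the bond multiplier–shift `𝔇_W S`
# (BS → BV), the contraction `ℭ_W` (BV → BS), the site multiplier `𝔰_V` (BS → BS), and the letter of the lattice divergence `div_n W` (dag-n15-c g23, n15-c∕225)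

Cell `pub-ymgap`, seat `pub-ymgap-dag-n15-c` (generation g23; R134 (a), s1; HUMAN RULING D-0062; chair R424 venue).  `bears_on: R4∕N15 · K3⁸ SpineGivenEndpointR13SepCoPHV
(stmt-QuantumFields-27366)`; filed `--supports stmt-QuantumFields-27366 --as helper` — COUNT-NEUTRAL.  One bookkeeping `def` (`bMulShift = 𝔇_W S` as one matrix) + theorems; 0 `sorry`.
Imports BY NAME n15-c∕224 (`bDiag`, `bShift`, `bContr`, `sDiag`, `bDiv` + `mulVec` formulas), n15-c∕215 (`le_mul_exp_of_dist_le_one`, `tdistT_blockOf_add_unitVec_le'`), n15-c∕213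
(`BlockRows.hasMaj_mulVecLin_of_sum_abs_le`).  Nothing in the tree is modified.

WHY (HOME HANDOFF «g24 BRICKS», brick B).  The CZ-free bootstrap for `(G′(T), ∂G′(T))` composes the PROVED flat rows (n15-c∕220) with three LOCAL operators; their sup-block rows are
elementary: `𝔇_W S ≤ w·e^{θ}e^{−θd}` (`w` = row letter of `W`; the shifted site is in a block at distance `≤ 1`), `ℭ_W ≤ (d+1)w` (same block), `𝔰_V ≤ v` (same block), and the letter of
`div_n W` is `≤ (d+1)·n·λ` for the Lipschitz letter `λ` of `W`.
* §1 `bMulShift`, `bMulShift_mulVec`, `bMulShift_mulVec_eq`; §2 ★ `hasMaj_bMulShift`, ★ `hasMaj_bContr`, ★ `hasMaj_sDiag`, ★ `rows_bDiv_le`.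

HONEST FRAMING ∕ LIMITS.  Elementary bookkeeping ([folklore]); MODEL carriers; NOT [Balaban1985BackgroundPropagators] as printed; NE2⁺ NOT PRINTED; N15 of record untouched (DISCHARGED AS CONSUMED,
p687738); counts UNMOVED (typed 28∕28 · discharged 8∕27); one finite 𝕋⁴ at fixed ε per index — NOT infinite volume ∕ OS ∕ mass gap ∕ Clay.  Restate-immune (no Theses import).
-/

noncomputable section

open scoped BigOperators Matrix
open Finset

namespace Summit.QuantumFields.YangMills.BalabanUVNodes.N15.CovLandau

open Literature.MathematicalPhysics.QuantumFieldTheory.Balaban1983to89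
open Literature.MathematicalPhysics.QuantumFieldTheory.Balaban1983to89.B5Prop11Plancherel (Tor fine unitVec)
open Literature.MathematicalPhysics.QuantumFieldTheory.Balaban1983to89.B11SectG (BlockNorm HasMaj)
open Literature.MathematicalPhysics.QuantumFieldTheory.Balaban1983to89.B6UnitTorusCarrier (unitTorusGeo)
open Literature.MathematicalPhysics.QuantumFieldTheory.Balaban1983to89.T4EtaRateCoeffDefect (fibre mem_fibre)
open Literature.MathematicalPhysics.QuantumFieldTheory.King1986.Torus (blockOf tdistT tdistT_nonneg tdistT_self tdistT_symm)
open Summit.QuantumFields.YangMills.BalabanUVNodes.N15.MatrixSpecies (liftBlk)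
open Summit.QuantumFields.YangMills.BalabanUVNodes.N15.BlockRows (hasMaj_mulVecLin_of_sum_abs_le)

variable {d : ℕ}

section Local

variable (M : Fin (d + 1) → ℕ) [∀ μ, NeZero (M μ)] (n : ℕ) [NeZero n] {ι : Type} [Fintype ι] [DecidableEq ι] (L k : ℕ)

/-! ## §1 `𝔇_W S` as one matrix -/

/-- `𝔇_W S` as one matrix: entry `[z = x + e_ν]·W_ν(x)_{ij}`. [folklore] -/
def bMulShift (W : Fin (d + 1) → Tor (fine n M) → Matrix ι ι ℝ) : Matrix ((Tor (fine n M) × Fin (d + 1)) × ι) (Tor (fine n M) × ι) ℝ :=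
  fun p q => if q.1 = p.1.1 + unitVec (fine n M) p.1.2 then W p.1.2 p.1.1 p.2 q.2 else 0

omit [DecidableEq ι] in
/-- `𝔇_W S` pointwise. [folklore] -/
theorem bMulShift_mulVec (W : Fin (d + 1) → Tor (fine n M) → Matrix ι ι ℝ) (f : Tor (fine n M) × ι → ℝ) (x : Tor (fine n M)) (ν : Fin (d + 1)) (i : ι) :
    (bMulShift M n W *ᵥ f) ((x, ν), i) = ∑ j, W ν x i j * f (x + unitVec (fine n M) ν, j) := by
  classical
  simp only [Matrix.mulVec, dotProduct, bMulShift]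
  rw [Fintype.sum_prod_type]
  simp only [ite_mul, zero_mul]
  rw [Finset.sum_eq_single (x + unitVec (fine n M) ν) (fun z _ hz => by simp [hz]) (fun h => absurd (Finset.mem_univ _) h)]
  simp

/-- `𝔇_W S = 𝔇_W ∘ S` on fields. [folklore] -/
theorem bMulShift_mulVec_eq (W : Fin (d + 1) → Tor (fine n M) → Matrix ι ι ℝ) (f : Tor (fine n M) × ι → ℝ) :
    bMulShift M n W *ᵥ f = bDiag M n W *ᵥ (bShift M n *ᵥ f) := by
  funext p
  obtain ⟨⟨x, ν⟩, i⟩ := p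
  simp only [bMulShift_mulVec, bDiag_mulVec, bShift_mulVec]

/-! ## §2 The rows -/

omit [DecidableEq ι] in
/-- total row of `𝔇_W S`. [folklore] -/
theorem bMulShift_row_le (W : Fin (d + 1) → Tor (fine n M) → Matrix ι ι ℝ) {w : ℝ} (hw : ∀ ν x i, ∑ j, |W ν x i j| ≤ w) (p : (Tor (fine n M) × Fin (d + 1)) × ι) :
    ∑ q, |bMulShift M n W p q| ≤ w := by
  classical
  rw [Fintype.sum_prod_type]
  simp only [bMulShift]
  rw [Finset.sum_eq_single (p.1.1 + unitVec (fine n M) p.1.2) (fun z _ hz => by simp [hz]) (fun h => absurd (Finset.mem_univ _) h)]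
  simp only [if_true]
  exact hw p.1.2 p.1.1 p.2

/-- ★ **`𝔇_W S : BS → BV` has the row `w·e^{θ}·e^{−θd}`** (`w` the row letter of `W`; the shifted site lies in a block at distance `≤ 1`). [folklore] -/
theorem hasMaj_bMulShift (W : Fin (d + 1) → Tor (fine n M) → Matrix ι ι ℝ) {w θ : ℝ} (hw0 : 0 ≤ w) (hθ : 0 ≤ θ) (hw : ∀ ν x i, ∑ j, |W ν x i j| ≤ w) :
    HasMaj (BlockNorm.ofBlocks (unitTorusGeo L k M) (liftBlk (blockOf n M) ι)) (BlockNorm.ofBlocks (unitTorusGeo L k M) (liftBlk (fun b : Tor (fine n M) × Fin (d + 1) => blockOf n M b.1) ι)) (Matrix.mulVecLin (bMulShift M n W)) (fun y y' => w * Real.exp θ * Real.exp (-(θ * tdistT M y y'))) := by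
  classical
  refine hasMaj_mulVecLin_of_sum_abs_le _ _ (fun y y' => by positivity) fun p w' => ?_
  change ∑ q ∈ fibre (liftBlk (blockOf n M) ι) w', |bMulShift M n W p q| ≤ w * Real.exp θ * Real.exp (-(θ * tdistT M (blockOf n M p.1.1) w'))
  by_cases hb : blockOf n M (p.1.1 + unitVec (fine n M) p.1.2) = w'
  · calc ∑ q ∈ fibre (liftBlk (blockOf n M) ι) w', |bMulShift M n W p q| ≤ ∑ q, |bMulShift M n W p q| := Finset.sum_le_univ_sum_of_nonneg fun q => abs_nonneg _
      _ ≤ w := bMulShift_row_le M n W hw p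
      _ ≤ w * Real.exp θ * Real.exp (-(θ * tdistT M (blockOf n M p.1.1) w')) :=
          le_mul_exp_of_dist_le_one hw0 hθ (by rw [← hb]; exact tdistT_blockOf_add_unitVec_le' M n p.1.1 p.1.2)
  · refine le_trans (le_of_eq (Finset.sum_eq_zero fun q hq => ?_)) (by positivity)
    have hq1 : blockOf n M q.1 = w' := (mem_fibre (liftBlk (blockOf n M) ι) w' q).1 hq
    have : ¬ q.1 = p.1.1 + unitVec (fine n M) p.1.2 := fun h => hb (by rw [← h]; exact hq1)
    simp [bMulShift, this]

omit [DecidableEq ι] in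
/-- total row of `ℭ_W`. [folklore] -/
theorem bContr_row_le (W : Fin (d + 1) → Tor (fine n M) → Matrix ι ι ℝ) {w : ℝ} (hw : ∀ μ z i, ∑ j, |W μ z i j| ≤ w) (q : Tor (fine n M) × ι) :
    ∑ p, |bContr M n W q p| ≤ ((d : ℝ) + 1) * w := by
  classical
  rw [Fintype.sum_prod_type, Fintype.sum_prod_type]
  simp only [bContr]
  rw [Finset.sum_eq_single q.1 (fun z _ hz => by simp [hz]) (fun h => absurd (Finset.mem_univ _) h)]
  simp only [if_true]
  calc ∑ μ, ∑ j, |W μ q.1 q.2 j| ≤ ∑ _μ : Fin (d + 1), w := Finset.sum_le_sum fun μ _ => hw μ q.1 q.2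
    _ = ((d : ℝ) + 1) * w := by rw [Finset.sum_const, Finset.card_univ, Fintype.card_fin, nsmul_eq_mul]; push_cast; ring

/-- ★ **`ℭ_W : BV → BS` has the row `(d+1)w·e^{−θd}`** (same block). [folklore] -/
theorem hasMaj_bContr (W : Fin (d + 1) → Tor (fine n M) → Matrix ι ι ℝ) {w θ : ℝ} (hw0 : 0 ≤ w) (hw : ∀ μ z i, ∑ j, |W μ z i j| ≤ w) :
    HasMaj (BlockNorm.ofBlocks (unitTorusGeo L k M) (liftBlk (fun b : Tor (fine n M) × Fin (d + 1) => blockOf n M b.1) ι)) (BlockNorm.ofBlocks (unitTorusGeo L k M) (liftBlk (blockOf n M) ι)) (Matrix.mulVecLin (bContr M n W)) (fun y y' => ((d : ℝ) + 1) * w * Real.exp (-(θ * tdistT M y y'))) := by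
  classical
  refine hasMaj_mulVecLin_of_sum_abs_le _ _ (fun y y' => by positivity) fun q w' => ?_
  change ∑ p ∈ fibre (liftBlk (fun b : Tor (fine n M) × Fin (d + 1) => blockOf n M b.1) ι) w', |bContr M n W q p| ≤ ((d : ℝ) + 1) * w * Real.exp (-(θ * tdistT M (blockOf n M q.1) w'))
  by_cases hb : blockOf n M q.1 = w'
  · calc ∑ p ∈ fibre (liftBlk (fun b : Tor (fine n M) × Fin (d + 1) => blockOf n M b.1) ι) w', |bContr M n W q p| ≤ ∑ p, |bContr M n W q p| :=
          Finset.sum_le_univ_sum_of_nonneg fun p => abs_nonneg _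
      _ ≤ ((d : ℝ) + 1) * w := bContr_row_le M n W hw q
      _ = ((d : ℝ) + 1) * w * Real.exp (-(θ * tdistT M (blockOf n M q.1) w')) := by rw [← hb, tdistT_self, mul_zero, neg_zero, Real.exp_zero, mul_one]
  · refine le_trans (le_of_eq (Finset.sum_eq_zero fun p hp => ?_)) (by positivity)
    have hp1 : blockOf n M p.1.1 = w' := (mem_fibre (liftBlk (fun b : Tor (fine n M) × Fin (d + 1) => blockOf n M b.1) ι) w' p).1 hp
    have : ¬ p.1.1 = q.1 := fun h => hb (by rw [← h]; exact hp1)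
    simp [bContr, this]

omit [DecidableEq ι] in
/-- total row of `𝔰_V`. [folklore] -/
theorem sDiag_row_le (V : Tor (fine n M) → Matrix ι ι ℝ) {v : ℝ} (hv : ∀ z i, ∑ j, |V z i j| ≤ v) (q : Tor (fine n M) × ι) : ∑ q', |sDiag M n V q q'| ≤ v := by
  classical
  rw [Fintype.sum_prod_type]
  simp only [sDiag]
  rw [Finset.sum_eq_single q.1 (fun z _ hz => by simp [hz]) (fun h => absurd (Finset.mem_univ _) h)]
  simp only [if_true]
  exact hv q.1 q.2

/-- ★ **`𝔰_V : BS → BS` has the row `v·e^{−θd}`** (same block). [folklore] -/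
theorem hasMaj_sDiag (V : Tor (fine n M) → Matrix ι ι ℝ) {v θ : ℝ} (hv0 : 0 ≤ v) (hv : ∀ z i, ∑ j, |V z i j| ≤ v) :
    HasMaj (BlockNorm.ofBlocks (unitTorusGeo L k M) (liftBlk (blockOf n M) ι)) (BlockNorm.ofBlocks (unitTorusGeo L k M) (liftBlk (blockOf n M) ι)) (Matrix.mulVecLin (sDiag M n V)) (fun y y' => v * Real.exp (-(θ * tdistT M y y'))) := by
  classical
  refine hasMaj_mulVecLin_of_sum_abs_le _ _ (fun y y' => by positivity) fun q w' => ?_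
  change ∑ q' ∈ fibre (liftBlk (blockOf n M) ι) w', |sDiag M n V q q'| ≤ v * Real.exp (-(θ * tdistT M (blockOf n M q.1) w'))
  by_cases hb : blockOf n M q.1 = w'
  · calc ∑ q' ∈ fibre (liftBlk (blockOf n M) ι) w', |sDiag M n V q q'| ≤ ∑ q', |sDiag M n V q q'| := Finset.sum_le_univ_sum_of_nonneg fun q' => abs_nonneg _
      _ ≤ v := sDiag_row_le M n V hv q
      _ = v * Real.exp (-(θ * tdistT M (blockOf n M q.1) w')) := by rw [← hb, tdistT_self, mul_zero, neg_zero, Real.exp_zero, mul_one]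
  · refine le_trans (le_of_eq (Finset.sum_eq_zero fun q' hq => ?_)) (by positivity)
    have hq1 : blockOf n M q'.1 = w' := (mem_fibre (liftBlk (blockOf n M) ι) w' q').1 hq
    have : ¬ q'.1 = q.1 := fun h => hb (by rw [← h]; exact hq1)
    simp [sDiag, this]

omit [∀ μ, NeZero (M μ)] [NeZero n] [DecidableEq ι] in
/-- ★ **THE LETTER OF THE LATTICE DIVERGENCE**: `Σ_j |(div_n W)(z)_{ij}| ≤ (d+1)·n·λ` for the Lipschitz letter `λ` of `W` (`Σ_j|(W_μ(z − e_μ) − W_μ(z))_{ij}| ≤ λ`). [folklore] -/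
theorem rows_bDiv_le (W : Fin (d + 1) → Tor (fine n M) → Matrix ι ι ℝ) {lam : ℝ} (hlam : ∀ μ z i, ∑ j, |(W μ (z - unitVec (fine n M) μ) - W μ z) i j| ≤ lam) (z : Tor (fine n M)) (i : ι) :
    ∑ j, |bDiv M n W z i j| ≤ ((d : ℝ) + 1) * (n : ℝ) * lam := by
  have hn : (0 : ℝ) ≤ n := Nat.cast_nonneg n
  calc ∑ j, |bDiv M n W z i j| = ∑ j, |∑ μ, (n : ℝ) * (W μ (z - unitVec (fine n M) μ) - W μ z) i j| := by
        refine Finset.sum_congr rfl fun j _ => ?_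
        simp only [bDiv, Matrix.sum_apply, Matrix.smul_apply, smul_eq_mul]
    _ ≤ ∑ j, ∑ μ, (n : ℝ) * |(W μ (z - unitVec (fine n M) μ) - W μ z) i j| :=
        Finset.sum_le_sum fun j _ => (Finset.abs_sum_le_sum_abs _ _).trans (le_of_eq (Finset.sum_congr rfl fun μ _ => by rw [abs_mul, abs_of_nonneg hn]))
    _ = ∑ μ, (n : ℝ) * ∑ j, |(W μ (z - unitVec (fine n M) μ) - W μ z) i j| := by rw [Finset.sum_comm]; simp only [Finset.mul_sum]
    _ ≤ ∑ _μ : Fin (d + 1), (n : ℝ) * lam := Finset.sum_le_sum fun μ _ => mul_le_mul_of_nonneg_left (hlam μ z i) hn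
    _ = ((d : ℝ) + 1) * (n : ℝ) * lam := by rw [Finset.sum_const, Finset.card_univ, Fintype.card_fin, nsmul_eq_mul]; push_cast; ring

end Local

end Summit.QuantumFields.YangMills.BalabanUVNodes.N15.CovLandau

end
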